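import Summits.Ventures.HSemireg.WedgeHankelFrameIntersection
import Summits.Ventures.HSemireg.WedgeHankelDivisorGeneric

/-!
# Venture HSemireg — THE SIEGEL IDEAL IS CUT OUT BY THE NODE KERNELS OF ANY DIVISOR OF TOTAL ORDER `≥ k + 1`, IN EVERY DEGREE:
# `⋂_i (SI_k ⊔ Φs λ_i (xRich(k, P_i))) = SI_k` whenever `Σ_i (P_i + 1) ≥ k + 1` (`k + P_i ≤ n`), and dually the co-Siegel space is the direct sum of the node
# images of ANY divisor of total order `k + 1`, in every degree — F2b/F2c/F6 without `D ≤ n + 1 − k` / `2k ≤ n` (module-valued Hermite interpolation)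

HONEST FRAMING. Part of the Lean index of the computation cell `pub-hsemireg` (seat p10 gen 17, Sunday typer «UNIFORM-IN-n»).
Finite-dimensional EXTERIOR ALGEBRA over a field ONLY: no variety, no cohomology theory, no sheaf, no Ext group, no semiregularity map;
nothing here says that HC / HC_CM / HC_AV holds; no Literature fact is declared or used.  Custodian versions as in `WedgeHankelSiegelIdeal` (1/3) and
`WedgeKernelDuality`; the dictionary (`Θ^t e^{λΘ}/t! ↦ w_n(expMul λ δ_t)`; the DIVISOR `Σ_i (P_i+1)[λ_i]`; `plane(a,b) ↔ H^b(⋀^a T)`) is QUOTED, never asserted.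

WHAT IS IN THE TREE.  F2b `Kr_w_expMul_sum` / F2c `Kr_w_expMul_sum_eq_siegelIdeal`: the kernel of ONE divisor class is the intersection of its node kernels, `= SI_k` once
`D = Σ_i (P_i+1) ≥ k + 1`, both under `D ≤ n + 1 − k` (the divisor RANK law); F6 `coSiegel_eq_iSup_V_expMul` (`2k ≤ n`); G3 `WedgeHankelFrameIntersection` (this seat):
simple nodes, every degree, by a Vandermonde argument on the top-x-count components `θ_a ∧ E_a`.  THIS FILE is the CONFLUENT version of G3 (namespace
`Summit.Ventures.HSemireg.Wedge.KernelDuality` continued; imports G3, F2c):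
* §90 `expMul_spike_apply` (`(expMul λ δ_t)_a = C(a,t) λ^{a−t}` — F2a's confluent node matrix `cvMat` entry); **`prj_top_mul_w`: `prj n k (θ ∧ w_n(q)) = Σ_{a ≤ k} q_a • (θ_a ∧ E_a)`
  for EVERY `q`** (`θ ∈ ⋀^k`, `k ≤ n`; G3's `prj_mul_vol` is `q = λ^•`).
* §91 **MODULE-VALUED HERMITE INTERPOLATION `eq_zero_of_forall_cvMat_smul_sum_eq_zero`**: if `Σ_{l<c} C(l,t) λ_i^{l−t} • u_l = 0` for all nodes `i` and `t ≤ P_i` with `c ≤ Σ_i (P_i+1)`,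
  distinct `λ_i`, then every `u_l = 0` (duals separate points + F2c's `cvMat_mulVecLin_injective`: a polynomial of degree `< D` vanishing on a divisor of total order `D` is zero).
* §92 **`mem_siegelIdeal_of_forall_mul_node_eq_zero`**: `θ ∈ ⋀^k` (`k ≤ n`) killed by all the node classes `w_n(expMul λ_i δ_t)`, `t ≤ P_i`, of a divisor of total order `≥ k + 1`
  lies in `SI_k` (§90/§91 ⇒ every `θ_a ∧ E_a = 0` ⇒ gen 11's block law); hence **`iInf_Kr_w_expMul_eq_siegelIdeal'`: `⋂_i Kr(univ, w_n(expMul λ_i q_i), k) = SI_k` for exact orders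
  `P_i` with `k + P_i ≤ n` and `Σ_i (P_i+1) ≥ k + 1`** (E5's node kernel law: the order-`(P_i+1)` node kernel lies in each `Kr(w_n(expMul λ_i δ_t))`, `t ≤ P_i`), and the NAMED form
  **`iInf_sup_map_Φs_xRich_eq_siegelIdeal`: `⋂_i (SI_k ⊔ Φs λ_i (xRich(k, P_i))) = SI_k`** — F2b's intersection with NO upper bound `D ≤ n + 1 − k`.
* §93 THE DUAL: **`coSiegel_eq_iSup_V_w_expMul'`: `coSiegel(k′+n) = ⨆_i V(univ, w_n(expMul λ_i q_i), k′)`** for `k + k′ = n`, exact orders `P_i ≤ k′`, `Σ_i (P_i+1) ≥ k + 1`; when the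
  total order is EXACTLY `k + 1` the sum is DIRECT (`iSupIndep_V_w_expMul''`, dimension count with F2d's `finrank_V_w_expMul_of_order`) — F6's co-Siegel decomposition by any
  finite divisor of total order `k + 1`, now in every degree.
NOT typed here: a node at `∞` inside the divisor (swap `Ψs`; mechanical), the kernel of the divisor CLASS itself in the mirror range (there `rank H_k < k + 1` and the
class kernel is strictly between `SI_k` and the intersection — no name claimed); anything Ext-side.  Class side only; new names only.
-/

open Module

namespace Summit.Ventures.HSemireg.Wedge.KernelDuality

open Summit.Ventures.HSemireg.Wedge Summit.Ventures.HSemireg.Wedge.Kunneth Summit.Ventures.HSemireg.Wedge.Hankel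
  Summit.Ventures.HSemireg.Wedge.HankelSiegel Summit.Ventures.HSemireg.Wedge.HankelSiegelIdeal Summit.Ventures.HSemireg.Wedge.KunnethKernel
  Summit.Ventures.HSemireg.Wedge.HankelSecant Summit.Ventures.HSemireg.Wedge.HankelFrameChange Summit.Ventures.HSemireg.Wedge.HankelPureKernel

variable (K : Type*) [Field K] {n : ℕ}

/-! ## §90. The top-x-count component of `θ ∧ w_n(q)`, and the node classes `Θ^t e^{λΘ}/t!` -/

/-- **`(expMul λ δ_t)_a = C(a,t) λ^{a−t}`** — the coefficient sequence of `Θ^t e^{λΘ}/t!` (dictionary quoted) is the `(·, t)`-row of F2a's confluent node matrix. -/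
lemma expMul_spike_apply (lam : K) (t a : ℕ) : expMul K lam (fun i => if i = t then (1 : K) else 0) a = (a.choose t : K) * lam ^ (a - t) := by
  rw [expMul_eq_sum]
  simp only [mul_ite, mul_one, mul_zero]
  rw [Finset.sum_ite_eq' (Finset.range (a + 1)) t]
  split_ifs with h
  · rfl
  · rw [Finset.mem_range, not_lt] at h
    rw [Nat.choose_eq_zero_of_lt (by omega), Nat.cast_zero, zero_mul]

/-- **THE TOP-x-COUNT COMPONENT OF `θ ∧ w_n(q)`: `prj n k (θ ∧ w_n(q)) = Σ_{a ≤ k} q_a • (prj a (k−a) θ ∧ E_a)`** for EVERY sequence `q` (`θ ∈ ⋀^k`, `k ≤ n`): in the expansion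
`θ ∧ w_n(q) = Σ_{a,p} q_p θ_a ∧ E_p` only the terms `p = a` have `n` x-letters. -/
theorem prj_top_mul_w {k : ℕ} (hk : k ≤ n) (q : ℕ → K) {θ : HT K (In n)} (hθ : θ ∈ ⋀[K]^k (In n → K)) :
    prj K n n k (θ * w K n n q) = ∑ a ∈ Finset.range (k + 1), q a • (prj K n a (k - a) θ * w K n n (fun j => if j = a then (1 : K) else 0)) := by
  have e : w K n n q = w K n n (fun j => if j ≤ n then q j else 0) := HankelRankOne.w_eq_of_agree K n fun i hi => by rw [if_pos hi]
  rw [e, mul_w_eq_sum_sum K (P := n) le_rfl (fun j hj => if_neg (by omega)) hθ, map_sum]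
  refine Finset.sum_congr rfl fun a ha => ?_
  rw [Finset.mem_range] at ha
  rw [map_sum, Finset.sum_eq_single a]
  · have hmem : prj K n a (k - a) θ * w K n n (fun j => if j = a then (1 : K) else 0) ∈ plane K n n k := by
      have := mul_w_spike_mem_plane K (p := a) (by omega) (prj_mem_plane K a (k - a) θ)
      rwa [show a + (n - a) = n by omega, show k - a + a = k by omega] at this
    rw [map_smul, prj_of_mem_plane K hmem]
    exact congrArg (· • _) (if_pos (by omega))
  · intro p hp hpa
    rw [Finset.mem_range] at hp
    rw [map_smul, prj_of_mem_plane_ne K (Or.inl (by omega)) (mul_w_spike_mem_plane K (by omega) (prj_mem_plane K a (k - a) θ)), smul_zero]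
  · intro h; exact absurd (Finset.mem_range.mpr (by omega)) h

/-! ## §91. Module-valued Hermite interpolation -/

/-- **MODULE-VALUED HERMITE INTERPOLATION**: distinct nodes `λ_i` with multiplicities `P_i + 1`, `c ≤ Σ_i (P_i + 1)`; if `Σ_{l<c} C(l,t) λ_i^{l−t} • u_l = 0` for every node `i`
and every `t ≤ P_i`, then every `u_l = 0` — apply any linear functional and F2c's `cvMat_mulVecLin_injective` («a polynomial of degree `< D` vanishing on a divisor of total
order `D` is zero»). -/
theorem eq_zero_of_forall_cvMat_smul_sum_eq_zero {M : Type*} [AddCommGroup M] [Module K M] {r : ℕ} {lam : Fin r → K} (hlam : Function.Injective lam)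
    (P : Fin r → ℕ) {c : ℕ} (hc : c ≤ ∑ i, (P i + 1)) {u : Fin c → M} (h : ∀ x : DIdx P, ∑ l : Fin c, cvMat K lam P c x l • u l = 0) (l : Fin c) :
    u l = 0 := by
  refine (Module.forall_dual_apply_eq_zero_iff K (u l)).mp fun φ => ?_
  have hv : (cvMat K lam P c).mulVecLin (fun l => φ (u l)) = 0 := by
    funext x
    have h1 := congrArg φ (h x)
    rw [map_sum, map_zero] at h1
    rw [Matrix.mulVecLin_apply, Matrix.mulVec, Pi.zero_apply, ← h1]
    refine Finset.sum_congr rfl fun l _ => ?_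
    rw [map_smul, smul_eq_mul]
  have := congr_fun (cvMat_mulVecLin_injective K hlam P hc (hv.trans (map_zero _).symm)) l
  simpa using this

/-! ## §92. The Siegel ideal is cut out by the node kernels of any divisor of total order `≥ k + 1` -/

/-- **A FORM KILLED BY ALL THE NODE CLASSES OF A DIVISOR OF TOTAL ORDER `≥ k + 1` IS ISOTROPIC**: `θ ∈ ⋀^k` (`k ≤ n`), distinct `λ_i`, `Σ_i (P_i+1) ≥ k + 1`,
`θ ∧ w_n(expMul λ_i δ_t) = 0` for all `i` and `t ≤ P_i` ⇒ `θ ∈ SI_k` (the top-x-count components say that the module-valued polynomial `Σ_a (θ_a ∧ E_a) X^a` of degree `≤ k`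
vanishes to order `P_i + 1` at each `λ_i`, §91; then gen 11's block law on each `θ_a`). -/
theorem mem_siegelIdeal_of_forall_mul_node_eq_zero {k r : ℕ} (hk : k ≤ n) {lam : Fin r → K} (hlam : Function.Injective lam) {P : Fin r → ℕ}
    (hD : k + 1 ≤ ∑ i, (P i + 1)) {θ : HT K (In n)} (hθ : θ ∈ ⋀[K]^k (In n → K))
    (h0 : ∀ (i : Fin r) (t : Fin (P i + 1)), θ * w K n n (expMul K (lam i) (fun j => if j = (t : ℕ) then (1 : K) else 0)) = 0) :
    θ ∈ siegelIdeal K n k := by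
  have hsys : ∀ x : DIdx P, ∑ l : Fin (k + 1), cvMat K lam P (k + 1) x l •
      (prj K n l (k - l) θ * w K n n (fun j => if j = (l : ℕ) then (1 : K) else 0)) = 0 := by
    rintro ⟨i, t⟩
    have h1 := congrArg (prj K n n k) (h0 i t)
    rw [map_zero, prj_top_mul_w K hk _ hθ, Finset.sum_range] at h1
    rw [← h1]
    refine Finset.sum_congr rfl fun l _ => ?_
    rw [cvMat_apply, expMul_spike_apply]
  have hua := eq_zero_of_forall_cvMat_smul_sum_eq_zero K hlam P hD hsys
  rw [← sum_prj K hθ]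
  refine Submodule.sum_mem _ fun a ha => ?_
  rw [Finset.mem_range] at ha
  have hE : prj K n a (k - a) θ * w K n n (fun j => if j = a then (1 : K) else 0) = 0 := hua ⟨a, ha⟩
  have hker : (⟨prj K n a (k - a) θ, prj_mem_plane K a (k - a) θ⟩ : plane K n a (k - a)) ∈
      LinearMap.ker (wedgeP K n a (k - a) (fun j => if j = a then (1 : K) else 0)) := by
    rw [LinearMap.mem_ker, wedgeP, LinearMap.comp_apply, Submodule.subtype_apply, LinearMap.mulRight_apply]; exact hE
  rw [ker_wedgeP_of_window_ne K (s := 0) (Nat.zero_le _) (by rw [Nat.add_zero, if_pos rfl]; exact one_ne_zero),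
    Submodule.mem_comap, Submodule.subtype_apply, show a + (k - a) = k by omega] at hker
  exact hker

/-- **THE SIEGEL IDEAL IS CUT OUT BY ALL THE NODE CLASSES OF ANY DIVISOR OF TOTAL ORDER `≥ k + 1`:
`⋂_i ⋂_{t ≤ P_i} Kr(univ, w_n(expMul λ_i δ_t), k) = SI_k`** (`k ≤ n`, distinct `λ_i`, `Σ_i (P_i+1) ≥ k + 1`; no other hypothesis). -/
theorem iInf_iInf_Kr_w_expMul_spike_eq_siegelIdeal {k r : ℕ} (hk : k ≤ n) {lam : Fin r → K} (hlam : Function.Injective lam) {P : Fin r → ℕ}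
    (hD : k + 1 ≤ ∑ i, (P i + 1)) :
    (⨅ i, ⨅ t : Fin (P i + 1), Kr K Finset.univ (w K n n (expMul K (lam i) (fun j => if j = (t : ℕ) then (1 : K) else 0))) k) = siegelIdeal K n k := by
  refine le_antisymm (fun θ hθ => ?_) (le_iInf fun i => le_iInf fun t => siegelIdeal_le_Kr_w K n k _)
  have hr : 0 < r := by
    rcases Nat.eq_zero_or_pos r with h | h
    · subst h; simp at hD
    · exact h
  simp only [Submodule.mem_iInf] at hθ
  have hθk : θ ∈ ⋀[K]^k (In n → K) := by
    have := (mem_Kr.mp (hθ ⟨0, hr⟩ 0)).1; rwa [Hom_univ_eq_exteriorPower] at this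
  exact mem_siegelIdeal_of_forall_mul_node_eq_zero K hk hlam hD hθk fun i t => (mem_Kr.mp (hθ i t)).2

/-- `xRich(k, ·)` is antitone in the letter bound: more than `P′ ≥ P` x-letters implies more than `P`. -/
lemma xRich_anti {k P P' : ℕ} (h : P ≤ P') : xRich K n k P' ≤ xRich K n k P :=
  iSup₂_le fun a ha => plane_le_xRich K (by have := (Finset.mem_Ioc.mp ha).1; omega) (Finset.mem_Ioc.mp ha).2

/-- the order-`(P+1)` node kernel lies in the kernel of each of its lower node classes: `SI_k ⊔ Φs λ (xRich(k, P)) ≤ Kr(univ, w_n(expMul λ δ_t), k)` for `t ≤ P`, `k + t ≤ n` (E5). -/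
lemma sup_map_Φs_xRich_le_Kr_w_expMul_spike (lam : K) {k P t : ℕ} (htP : t ≤ P) (hkt : k + t ≤ n) :
    siegelIdeal K n k ⊔ (xRich K n k P).map (Φs K (n := n) lam).toLinearMap ≤
      Kr K Finset.univ (w K n n (expMul K lam (fun j => if j = t then (1 : K) else 0))) k := by
  rw [Kr_w_expMul_of_order K lam (P := t) hkt (fun j hj => if_neg (by omega)) (by rw [if_pos rfl]; exact one_ne_zero)]
  exact sup_le_sup_left (Submodule.map_mono (xRich_anti K htP)) _

/-- **THE NAMED FORM: `⋂_i (SI_k ⊔ Φs λ_i (xRich(k, P_i))) = SI_k`** for distinct `λ_i`, `k + P_i ≤ n` for all `i`, and `Σ_i (P_i + 1) ≥ k + 1` — the forms with «more than `P_i`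
letters from the frame `{x_a + λ_i y_a}` modulo `SI_k`» for every `i` are exactly the Siegel ideal, with NO upper bound `D ≤ n + 1 − k` (F2b/F2c). -/
theorem iInf_sup_map_Φs_xRich_eq_siegelIdeal {k r : ℕ} {lam : Fin r → K} (hlam : Function.Injective lam) {P : Fin r → ℕ} (hkP : ∀ i, k + P i ≤ n)
    (hD : k + 1 ≤ ∑ i, (P i + 1)) :
    (⨅ i, siegelIdeal K n k ⊔ (xRich K n k (P i)).map (Φs K (n := n) (lam i)).toLinearMap) = siegelIdeal K n k := by
  have hr : 0 < r := by
    rcases Nat.eq_zero_or_pos r with h | h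
    · subst h; simp at hD
    · exact h
  have hk : k ≤ n := by have := hkP ⟨0, hr⟩; omega
  refine le_antisymm ?_ (le_iInf fun i => le_sup_left)
  have hle : (⨅ i, siegelIdeal K n k ⊔ (xRich K n k (P i)).map (Φs K (n := n) (lam i)).toLinearMap) ≤
      ⨅ i, ⨅ t : Fin (P i + 1), Kr K Finset.univ (w K n n (expMul K (lam i) (fun j => if j = (t : ℕ) then (1 : K) else 0))) k :=
    le_iInf fun i => le_iInf fun t => (iInf_le _ i).trans
      (sup_map_Φs_xRich_le_Kr_w_expMul_spike K (lam i) (P := P i) (t := (t : ℕ)) (by have := t.2; omega) (by have := t.2; have := hkP i; omega))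
  exact hle.trans (iInf_iInf_Kr_w_expMul_spike_eq_siegelIdeal K hk hlam hD).le

/-- **THE CLASS FORM: `⋂_i Kr(univ, w_n(expMul λ_i q_i), k) = SI_k`** for distinct `λ_i`, `q_i` of exact order `P_i` (supported on `[0, P_i]`, `q_i(P_i) ≠ 0`), `k + P_i ≤ n`,
`Σ_i (P_i + 1) ≥ k + 1` — F2b's intersection of node kernels is the Siegel ideal as soon as the total order reaches `k + 1`, in EVERY such degree. -/
theorem iInf_Kr_w_expMul_eq_siegelIdeal' {k r : ℕ} {lam : Fin r → K} (hlam : Function.Injective lam) {P : Fin r → ℕ} {q : Fin r → ℕ → K}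
    (hq : ∀ i j, P i < j → q i j = 0) (hqP : ∀ i, q i (P i) ≠ 0) (hkP : ∀ i, k + P i ≤ n) (hD : k + 1 ≤ ∑ i, (P i + 1)) :
    (⨅ i, Kr K Finset.univ (w K n n (expMul K (lam i) (q i))) k) = siegelIdeal K n k := by
  have e : ∀ i, Kr K Finset.univ (w K n n (expMul K (lam i) (q i))) k = siegelIdeal K n k ⊔ (xRich K n k (P i)).map (Φs K (n := n) (lam i)).toLinearMap :=
    fun i => Kr_w_expMul_of_order K (lam i) (hkP i) (hq i) (hqP i)
  simp only [e]
  exact iInf_sup_map_Φs_xRich_eq_siegelIdeal K hlam hkP hD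

/-! ## §93. The dual: the co-Siegel space is the sum of the node images of any divisor of total order `≥ k + 1`, direct when `= k + 1` -/

/-- **`coSiegel(k′ + n) = ⨆_i V(univ, w_n(expMul λ_i q_i), k′)`** for `k + k′ = n`, distinct `λ_i`, exact orders `P_i ≤ k′`, `Σ_i (P_i + 1) ≥ k + 1` — every co-Siegel form is a
sum of forms `θ_i ∧ (node class i)`; F6's `coSiegel_eq_iSup_V_expMul` needed `2k ≤ n` and total order exactly `k + 1`. -/
theorem coSiegel_eq_iSup_V_w_expMul' {k k' r : ℕ} (hkk' : k + k' = n) {lam : Fin r → K} (hlam : Function.Injective lam) {P : Fin r → ℕ} {q : Fin r → ℕ → K}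
    (hq : ∀ i j, P i < j → q i j = 0) (hqP : ∀ i, q i (P i) ≠ 0) (hPk' : ∀ i, P i ≤ k') (hD : k + 1 ≤ ∑ i, (P i + 1)) :
    coSiegel K n (k' + n) = ⨆ i, V K (In n) Finset.univ (w K n n (expMul K (lam i) (q i))) k' := by
  have hr : 0 < r := by
    rcases Nat.eq_zero_or_pos r with h | h
    · subst h; simp at hD
    · exact h
  have hle : (⨆ i, V K (In n) Finset.univ (w K n n (expMul K (lam i) (q i))) k') ≤ coSiegel K n (k' + n) :=
    iSup_le fun i => V_w_le_coSiegel K hkk' _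
  have hAnn : Ann K k (⨆ i, V K (In n) Finset.univ (w K n n (expMul K (lam i) (q i))) k') = siegelIdeal K n k := by
    rw [Ann_iSup_V_w_eq_iInf_Kr K hkk' hr, iInf_Kr_w_expMul_eq_siegelIdeal' K hlam hq hqP (fun i => by have := hPk' i; omega) hD]
  symm
  refine Submodule.eq_of_le_of_finrank_eq hle ?_
  have h1 := finrank_Ann_add K (a := k) (b := k' + n) (I := In n) (by rw [Fintype.card_fin]; omega) (hle.trans (coSiegel_le_Hom K (k' + n)))
  rw [hAnn, Fintype.card_fin] at h1
  have h2 := finrank_siegelIdeal K (n := n) k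
  rw [finrank_coSiegel K (show k + (k' + n) = n + n by omega)]
  omega

/-- **… AND FOR TOTAL ORDER EXACTLY `k + 1` THE SUM IS DIRECT** (`iSupIndep`; each node image has dimension `(P_i + 1)·C(n, k′)`, F2d). -/
theorem iSupIndep_V_w_expMul'' {k k' r : ℕ} (hkk' : k + k' = n) {lam : Fin r → K} (hlam : Function.Injective lam) {P : Fin r → ℕ} {q : Fin r → ℕ → K}
    (hq : ∀ i j, P i < j → q i j = 0) (hqP : ∀ i, q i (P i) ≠ 0) (hPk' : ∀ i, P i ≤ k') (hD : ∑ i, (P i + 1) = k + 1) :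
    iSupIndep (fun i => V K (In n) Finset.univ (w K n n (expMul K (lam i) (q i))) k') := by
  classical
  set F : Fin r → Submodule K (HT K (In n)) := fun i => V K (In n) Finset.univ (w K n n (expMul K (lam i) (q i))) k' with hF
  have hPi : ∀ i, P i + 1 ≤ ∑ j, (P j + 1) := fun i => Finset.single_le_sum (fun j _ => Nat.zero_le (P j + 1)) (Finset.mem_univ i)
  have hdimF : ∀ i, finrank K (F i) = (P i + 1) * n.choose k' := fun i =>
    finrank_V_w_expMul_of_order K (lam i) (hPk' i) (by have := hPi i; omega) (hq i) (hqP i)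
  have htot : finrank K ↥(⨆ i, F i) = ∑ i, finrank K (F i) := by
    rw [hF, ← coSiegel_eq_iSup_V_w_expMul' K hkk' hlam hq hqP hPk' hD.ge, finrank_coSiegel K (show k + (k' + n) = n + n by omega),
      Finset.sum_congr rfl fun i _ => hdimF i, ← Finset.sum_mul, hD, ← Nat.choose_symm (show k ≤ n by omega), show n - k = k' by omega]
  intro i
  have hrest_eq : (⨆ (j) (_ : j ≠ i), F j) = (Finset.univ.erase i).sup F := by
    rw [Finset.sup_eq_iSup]
    refine iSup_congr fun j => ?_
    by_cases hj : j = i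
    · subst hj; simp
    · simp [hj]
  have hfs : finrank K ↥((Finset.univ.erase i).sup F) ≤ ∑ j ∈ Finset.univ.erase i, finrank K (F j) := by
    induction (Finset.univ.erase i) using Finset.induction_on with
    | empty => rw [Finset.sup_empty, finrank_bot, Finset.sum_empty]
    | insert a s ha ih =>
      rw [Finset.sup_insert, Finset.sum_insert ha]
      exact (Submodule.finrank_add_le_finrank_add_finrank _ _).trans (Nat.add_le_add_left ih _)
  have hrest : finrank K ↥(⨆ (j) (_ : j ≠ i), F j) ≤ ∑ j ∈ Finset.univ.erase i, finrank K (F j) := by rw [hrest_eq]; exact hfs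
  have hsplit : (⨆ j, F j) = F i ⊔ ⨆ (j) (_ : j ≠ i), F j := by
    apply le_antisymm
    · refine iSup_le fun j => ?_
      by_cases hj : j = i
      · subst hj; exact le_sup_left
      · exact (le_iSup₂ (f := fun j (_ : j ≠ i) => F j) j hj).trans le_sup_right
    · exact sup_le (le_iSup F i) (iSup₂_le fun j _ => le_iSup F j)
  have hsum : ∑ j, finrank K (F j) = finrank K (F i) + ∑ j ∈ Finset.univ.erase i, finrank K (F j) :=
    (Finset.add_sum_erase _ _ (Finset.mem_univ i)).symm
  have hdim := Submodule.finrank_sup_add_finrank_inf_eq (F i) (⨆ (j) (_ : j ≠ i), F j)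
  rw [← hsplit, htot, hsum] at hdim
  have h0 : finrank K ↥(F i ⊓ ⨆ (j) (_ : j ≠ i), F j) = 0 := by omega
  rw [disjoint_iff, Submodule.finrank_eq_zero.mp h0]

end Summit.Ventures.HSemireg.Wedge.KernelDuality
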